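import Literature.AlgebraicGeometry.HodgeTheory.WeilTypeHodgeRingOfCentralizerDetOne
import Literature.AlgebraicGeometry.Milne1999.SpecialLefschetzGroupInvariantsHolds
import HarnessLib

/-!
# The Hodge ring of an abelian variety of Weil type whose Hodge group contains `S(A)(ℂ) ∩ SU_K` — divisor classes and
# the Weil plane, for an ARBITRARY endomorphism algebra with `K` central (Milne's Cor. 4.5 for every abelian variety)

Family `hodge`, layer `Literature/AlgebraicGeometry/HodgeTheory`, namespace `Literature.AlgebraicGeometry.HodgeTheory`
(helpers in `WeilDetOneGeneral`, verbatim private copies of those of `WeilTypeHodgeRingOfCentralizerDetOne`). THEOREMS ONLY.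
Written for the cell `pub-hodgeav-hg6` (req-37 (A) Q2b; eng-4 g6, lead g2 2026-08-29T00:51:12Z: TABLE X rows 20 `E_K² × Y₄(3,1)`
and 27 `E_K² × Y₄/M`, whose `End⁰ ⊇ M₂(K)` is not single-generated). HONEST FRAMING: nothing here proves HC / HC_AV / HC_CM;
the group hypothesis is the GENERAL member, displayed.

THE CHANGE w.r.t. `isDivisorWeilGenerated_of_hodgeGroup_ge_unitaryCentralizer_detOne`: Milne's single-generator data
(`C(A) ⊗ ℂ` = commutant of one `φ_E^*`, adjoint `J'`) is replaced by the tree's UNRESTRICTED form of Milne 1999 Cor. 4.5 /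
Thm. 3.2 — `Milne1999.mem_divisorClassesSpan_of_forall_mem_unitaryCentralizerGroup`: for ANY complex abelian variety and ANY
`h ∈ B¹(A) ⊗ ℂ` with `Q_h` non-degenerate, the `S(A)(ℂ)`-invariants are Lefschetz classes. The `K`-torus argument (torus in
`S(A)(ℂ)` needs only `φ^*` CENTRAL and `W, W̄` isotropic; `det_W = c^{2n}`; `t_ζ` confines Hodge classes to balanced monomials
and tops; the balanced part is `S(A)(ℂ)`-invariant) is unchanged. Statement: `isDivisorWeilGenerated_of_hodgeGroup_ge_unitaryCentralizer_detOne_general`.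
[cite: Milne1999LefschetzClasses, Thm. 3.2, Thm. 4.4 and Cor. 4.5] [cite: vanGeemen1994HodgeAV, Thm. 6.12] [cite: MoonenZarhin1998WeilClasses, §1]
-/

noncomputable section

open CategoryTheory Polynomial
open Literature.AlgebraicTopology.SingularHomology
open Literature.AlgebraicGeometry.Motives
open Literature.AlgebraicGeometry.VanGeemen1994
open Literature.AlgebraicGeometry.Milne1999
open Literature.Barriers.HodgeConjecture (divisorClassesSpan)

namespace Literature.AlgebraicGeometry.HodgeTheory

open WeilDetOne

namespace WeilDetOneGeneral

variable {A : AbelianVariety ℂ} {φ : A ⟶ A} {n d : ℕ}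
variable (hd : 0 < d) (hφ : φ ≫ φ = -(d • 𝟙 A))


variable {c : ℂˣ} {t : complexBetti A.X 1 ≃ₗ[ℂ] complexBetti A.X 1}
  (ht : ∀ x ∈ eigW A φ d, t x = (c : ℂ) • x) (ht' : ∀ y ∈ eigWbar A φ d, t y = ((c⁻¹ : ℂˣ) : ℂ) • y)

include hd hφ ht ht' in
/-- `t_c ∘ t_{c⁻¹} = 1`. [folklore] -/
private theorem kTorus_mul_kTorus_inv {t' : complexBetti A.X 1 ≃ₗ[ℂ] complexBetti A.X 1}
    (ht'₁ : ∀ x ∈ eigW A φ d, t' x = ((c⁻¹ : ℂˣ) : ℂ) • x)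
    (ht'₂ : ∀ y ∈ eigWbar A φ d, t' y = ((c⁻¹⁻¹ : ℂˣ) : ℂ) • y) : t * t' = 1 := by
  refine LinearEquiv.ext fun v ↦ ?_
  obtain ⟨x, hx, y, hy, rfl⟩ := exists_add_of_isCompl hd hφ v
  rw [LinearEquiv.mul_apply, kTorus_apply_add ht'₁ ht'₂ hx hy,
    kTorus_apply_add ht ht' (Submodule.smul_mem _ _ hx) (Submodule.smul_mem _ _ hy), smul_smul, smul_smul,
    inv_inv, Units.inv_mul, Units.mul_inv, one_smul, one_smul]
  rfl

variable {h : complexBetti A.X 2}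

variable {b : Module.Basis (Fin (2 * n + 2 * n)) ℂ (complexBetti A.X 1)}
  (hb₁ : ∀ i, b (Fin.castAdd (2 * n) i) ∈ eigW A φ d) (hb₂ : ∀ j, b (Fin.natAdd (2 * n) j) ∈ eigWbar A φ d)

/-- `a(s) + b(s) = |s|` for the numbers of `W`- and `W̄`-letters of an index set. [folklore] -/
private theorem card_filter_lt_add (s : Finset (Fin (2 * n + 2 * n))) :
    (s.filter fun j ↦ j.val < 2 * n).card + (s.filter fun j ↦ ¬ j.val < 2 * n).card = s.card :=
  Finset.card_filter_add_card_filter_not _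

/-- `a(s) ≤ 2n` (the `W`-letters are among the `2n` indices `< 2n`). [folklore] -/
private theorem card_filter_lt_le (s : Finset (Fin (2 * n + 2 * n))) : (s.filter fun j ↦ j.val < 2 * n).card ≤ 2 * n := by
  classical
  calc (s.filter fun j ↦ j.val < 2 * n).card
      ≤ ((Finset.univ : Finset (Fin (2 * n + 2 * n))).filter fun j ↦ j.val < 2 * n).card :=
        Finset.card_le_card (Finset.filter_subset_filter _ (Finset.subset_univ _))
    _ = (Finset.univ.map (Fin.castAddEmb (2 * n) : Fin (2 * n) ↪ Fin (2 * n + 2 * n))).card := by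
        congr 1
        ext j
        simp only [Finset.mem_filter, Finset.mem_univ, true_and, Finset.mem_map, Fin.castAddEmb_apply]
        constructor
        · intro hj; exact ⟨⟨j, hj⟩, Fin.ext rfl⟩
        · rintro ⟨i, rfl⟩; exact i.2
    _ = 2 * n := by rw [Finset.card_map, Finset.card_univ, Fintype.card_fin]

/-- `b(s) ≤ 2n`. [folklore] -/
private theorem card_filter_not_lt_le (s : Finset (Fin (2 * n + 2 * n))) :
    (s.filter fun j ↦ ¬ j.val < 2 * n).card ≤ 2 * n := by
  classical
  calc (s.filter fun j ↦ ¬ j.val < 2 * n).card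
      ≤ ((Finset.univ : Finset (Fin (2 * n + 2 * n))).filter fun j ↦ ¬ j.val < 2 * n).card :=
        Finset.card_le_card (Finset.filter_subset_filter _ (Finset.subset_univ _))
    _ = (Finset.univ.map (Fin.natAddEmb (2 * n) : Fin (2 * n) ↪ Fin (2 * n + 2 * n))).card := by
        congr 1
        ext j
        simp only [Finset.mem_filter, Finset.mem_univ, true_and, Finset.mem_map, Fin.natAddEmb_apply, not_lt]
        constructor
        · intro hj
          refine ⟨⟨j - 2 * n, by omega⟩, Fin.ext ?_⟩
          simp only [Fin.val_natAdd]; omega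
        · rintro ⟨i, rfl⟩; simp
    _ = 2 * n := by rw [Finset.card_map, Finset.card_univ, Fintype.card_fin]

include ht ht' hb₁ hb₂ in
/-- Coordinates under the diagonal action: `(⋀^q t_c x)_s = c^{a(s)} c^{-b(s)} x_s`. [folklore] -/
private theorem repr_extAct_kTorus (q : ℕ) (x : complexBetti A.X q) (s : Set.powersetCard (Fin (2 * n + 2 * n)) q) :
    (monB b q).repr (extAct (t : complexBetti A.X 1 →ₗ[ℂ] complexBetti A.X 1) q x) s =
      ((c : ℂ) ^ (s.val.filter fun j ↦ j.val < 2 * n).card *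
        ((c⁻¹ : ℂˣ) : ℂ) ^ (s.val.filter fun j ↦ ¬ j.val < 2 * n).card) * (monB b q).repr x s := by
  classical
  set B := monB b q with hB
  conv_lhs => rw [← B.sum_repr x, map_sum]
  simp_rw [map_smul, hB, extAct_kTorus_monB ht ht' hb₁ hb₂ q, smul_smul, map_sum, map_smul, Module.Basis.repr_self,
    Finsupp.smul_single, smul_eq_mul, mul_one]
  rw [Finset.sum_apply', Finset.sum_eq_single s]
  · rw [Finsupp.single_eq_same, mul_comm]
  · intro u _ hu; rw [Finsupp.single_eq_of_ne (Ne.symm hu)]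
  · intro hs; exact absurd (Finset.mem_univ s) hs

/-- If `a` commutes with `b` then `a` commutes with every polynomial in `b`. [folklore] -/
private theorem commute_aeval_of_commute {R S : Type*} [CommSemiring R] [Semiring S] [Algebra R S] {a b : S}
    (hab : Commute a b) (p : R[X]) : Commute a (aeval b p) := by
  refine p.induction_on (fun r ↦ ?_) (fun p q hp hq ↦ ?_) (fun m r h ↦ ?_)
  · rw [aeval_C]; exact (Algebra.commute_algebraMap_left r a).symm
  · rw [map_add]; exact hp.add_right hq
  · rw [pow_succ, ← mul_assoc, map_mul, aeval_X]
    exact h.mul_right hab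

/-- The weight `2^{a} · 2^{-b}` is `1` iff `a = b`. [folklore] -/
private theorem two_pow_mul_inv_pow_eq_one_iff (a b : ℕ) :
    ((Units.mk0 (2 : ℂ) two_ne_zero : ℂˣ) : ℂ) ^ a * (((Units.mk0 (2 : ℂ) two_ne_zero)⁻¹ : ℂˣ) : ℂ) ^ b = 1 ↔
      a = b := by
  rw [Units.val_inv_eq_inv_val, Units.val_mk0, inv_pow, mul_inv_eq_one₀ (pow_ne_zero _ two_ne_zero)]
  constructor
  · intro h
    have h' : ((2 ^ a : ℕ) : ℂ) = ((2 ^ b : ℕ) : ℂ) := by push_cast; exact h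
    exact Nat.pow_right_injective (le_refl 2) (Nat.cast_injective h')
  · intro h; rw [h]

include ht ht' hb₁ hb₂ in
/-- **The eigenvalue-one idempotent of `⋀^q t₂` as a polynomial** (Lagrange; here `c = 2`): there is a
polynomial `P` with `P(⋀^q t₂) b_s = b_s` for balanced `s` (`a(s) = b(s)`) and `= 0` otherwise. [folklore] -/
private theorem exists_balancedProjector (hc2 : c = Units.mk0 (2 : ℂ) two_ne_zero) (q : ℕ) :
    ∃ P : ℂ[X], ∀ s : Set.powersetCard (Fin (2 * n + 2 * n)) q,
      aeval (extAct (t : complexBetti A.X 1 →ₗ[ℂ] complexBetti A.X 1) q) P (monB b q s) =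
        if (s.val.filter fun j ↦ j.val < 2 * n).card = (s.val.filter fun j ↦ ¬ j.val < 2 * n).card
        then monB b q s else 0 := by
  classical
  subst hc2
  set wt : Set.powersetCard (Fin (2 * n + 2 * n)) q → ℂ := fun s ↦
    ((Units.mk0 (2 : ℂ) two_ne_zero : ℂˣ) : ℂ) ^ (s.val.filter fun j ↦ j.val < 2 * n).card *
      (((Units.mk0 (2 : ℂ) two_ne_zero)⁻¹ : ℂˣ) : ℂ) ^ (s.val.filter fun j ↦ ¬ j.val < 2 * n).card with hwt
  set T := (Finset.univ.image wt).erase 1 with hT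
  refine ⟨∏ v ∈ T, (C (1 - v)⁻¹ * (X - C v)), fun s ↦ ?_⟩
  have hev : extAct (t : complexBetti A.X 1 →ₗ[ℂ] complexBetti A.X 1) q (monB b q s) = wt s • monB b q s :=
    extAct_kTorus_monB ht ht' hb₁ hb₂ q s
  rw [Module.End.aeval_apply_of_mem_apply_eq_smul hev, eval_prod]
  simp only [eval_mul, eval_C, eval_sub, eval_X]
  by_cases hs : (s.val.filter fun j ↦ j.val < 2 * n).card = (s.val.filter fun j ↦ ¬ j.val < 2 * n).card
  · rw [if_pos hs]
    have h1 : wt s = 1 := (two_pow_mul_inv_pow_eq_one_iff _ _).2 hs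
    rw [h1, Finset.prod_eq_one fun v hv ↦ ?_, one_smul]
    have hv1 : v ≠ 1 := (Finset.mem_erase.1 hv).1
    exact inv_mul_cancel₀ (sub_ne_zero.2 hv1.symm)
  · rw [if_neg hs]
    have h1 : wt s ≠ 1 := fun h ↦ hs ((two_pow_mul_inv_pow_eq_one_iff _ _).1 h)
    have hmem : wt s ∈ T := Finset.mem_erase.2 ⟨h1, Finset.mem_image_of_mem _ (Finset.mem_univ s)⟩
    rw [Finset.prod_eq_zero hmem (by rw [sub_self, mul_zero]), zero_smul]

/-- A top-plus index set (`b(s) = 0`) consists of `W`-indices only. [folklore] -/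
private theorem forall_lt_of_top (s : Finset (Fin (2 * n + 2 * n))) (hb : (s.filter fun j ↦ ¬ j.val < 2 * n).card = 0) :
    ∀ j ∈ s, j.val < 2 * n := by
  classical
  intro j hj
  by_contra hj'
  have : j ∈ s.filter fun j ↦ ¬ j.val < 2 * n := Finset.mem_filter.2 ⟨hj, hj'⟩
  rw [Finset.card_eq_zero] at hb
  rw [hb] at this
  exact absurd this (Finset.notMem_empty j)

/-- A top-minus index set (`a(s) = 0`) consists of `W̄`-indices only. [folklore] -/
private theorem forall_le_of_top (s : Finset (Fin (2 * n + 2 * n))) (ha : (s.filter fun j ↦ j.val < 2 * n).card = 0) :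
    ∀ j ∈ s, ¬ j.val < 2 * n := by
  classical
  intro j hj hj'
  have : j ∈ s.filter fun j ↦ j.val < 2 * n := Finset.mem_filter.2 ⟨hj, hj'⟩
  rw [Finset.card_eq_zero] at ha
  rw [ha] at this
  exact absurd this (Finset.notMem_empty j)

end WeilDetOneGeneral

/-! ### The theorem (general endomorphism algebra) -/

open WeilDetOneGeneral in
/-- **The Hodge ring of an abelian variety of Weil type whose Hodge group contains `S(A)(ℂ) ∩ SU_K` is generated by
divisor classes and the Weil plane — GENERAL form (no hypothesis on `End⁰(A)` beyond the centrality of `φ`).** Let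
`dim A = 2n` (`n ≥ 1`), `φ ≫ φ = -d` (`d ≥ 1`) with `φ^*` CENTRAL (`φ^* ∈ C(A) ⊗ ℂ`: `φ` commutes with every
endomorphism, i.e. `K = ℚ(φ)` lies in the centre of `End⁰(A)`) and a `d`-similitude of `Q_h`, for a class `h ∈ B¹(A) ⊗ ℂ`
with `Q_h` non-degenerate on `H¹`. If every `u ∈ S(A)(ℂ) = unitaryCentralizerGroup A h` with `det(u | W) = 1` lies in
`hodgeGroupOne A.dim A.X` («`Hg(A) ⊇ S(A)(ℂ) ∩ SU_K`», the GENERAL member; displayed), then `IsDivisorWeilGenerated A φ n d`.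
Same proof as `isDivisorWeilGenerated_of_hodgeGroup_ge_unitaryCentralizer_detOne` (the `K`-torus weight splitting), with
Milne's Cor. 4.5 for EVERY complex abelian variety (`Milne1999.mem_divisorClassesSpan_of_forall_mem_unitaryCentralizerGroup`,
`Milne1999/SpecialLefschetzGroupInvariantsHolds`) in place of the single-generator theorem: so `End⁰(A)` may be
non-commutative (e.g. `E_K² × Y`, `End⁰ ⊇ M₂(K)`: TABLE X rows 20 / 27). [cite: Milne1999LefschetzClasses, Thm. 3.2, Thm. 4.4 and Cor. 4.5]
[cite: vanGeemen1994HodgeAV, Thm. 6.12 and its proof] [cite: MoonenZarhin1998WeilClasses, §1] -/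

theorem isDivisorWeilGenerated_of_hodgeGroup_ge_unitaryCentralizer_detOne_general (A : AbelianVariety ℂ) (φ : A ⟶ A)
    {n d : ℕ} (hn : 0 < n) (hA : A.dim = 2 * n) (hd : 0 < d) (hφ : φ ≫ φ = -(d • 𝟙 A))
    -- a class `h ∈ B¹(A) ⊗ ℂ` with non-degenerate `Q_h` (e.g. a rational class with a Kähler multiple)
    {h : complexBetti A.X 2} (hh : h ∈ hodgeClassSpan A.dim A.X 1)
    (hnd : ∀ x : complexBetti A.X 1, (∀ y, polarizationPairingOne A.X h (A.dim - 1) x y = 0) → x = 0)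
    -- the `K`-structure: `φ^*` central and a `d`-similitude of `Q_h`
    (hφC : pullbackOne A φ ∈ centralizerAlgebra A)
    (hφQ : ∀ x y, polarizationPairingOne A.X h (A.dim - 1) (pullbackOne A φ x) (pullbackOne A φ y) =
      (d : ℂ) • polarizationPairingOne A.X h (A.dim - 1) x y)
    -- the general member: `Hg ⊇ S(A)(ℂ) ∩ SU_K`
    (hG : ∀ (u : complexBetti A.X 1 ≃ₗ[ℂ] complexBetti A.X 1) (hu : u ∈ unitaryCentralizerGroup A h),
      detOnEigenspace u (pullbackOne A φ) (fun x ↦ (mem_centralizerGroup_iff.1 hu.1) φ x)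
        (Complex.I * (Real.sqrt d : ℂ)) = 1 → u ∈ hodgeGroupOne A.dim A.X) :
    IsDivisorWeilGenerated A φ n d := by
  classical
  -- the torus family and the adapted basis
  have hT := fun c : ℂˣ ↦ exists_kTorus (A := A) hd hφ c
  choose T hT₁ hT₂ using hT
  obtain ⟨B1, hb₁, hb₂⟩ := exists_kBasis (A := A) hd hφ hA
  have h2n : 0 < 2 * n := by omega
  -- the primitive root of unity
  set ζ₀ : ℂ := Complex.exp (2 * Real.pi * Complex.I / (2 * n : ℕ)) with hζ₀
  have hζ : IsPrimitiveRoot ζ₀ (2 * n) := Complex.isPrimitiveRoot_exp (2 * n) (by omega)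
  have hζne : ζ₀ ≠ 0 := hζ.ne_zero (by omega)
  set ζ : ℂˣ := Units.mk0 ζ₀ hζne with hζu
  have hζ' : IsPrimitiveRoot (ζ : ℂ) (2 * n) := hζ
  set two : ℂˣ := Units.mk0 (2 : ℂ) two_ne_zero with htwo
  -- (1) the torus elements lie in `S(A)(ℂ)`, commute with `φ^*`, and have `det = c^{2n}`
  have hTmem : ∀ c : ℂˣ, T c ∈ unitaryCentralizerGroup A h :=
    fun c ↦ kTorus_mem_unitaryCentralizerGroup hd hφ (hT₁ c) (hT₂ c) hφC hφQ
  have hTdet : ∀ c : ℂˣ, detOnEigenspace (T c) (pullbackOne A φ)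
      (fun x ↦ (mem_centralizerGroup_iff.1 (hTmem c).1) φ x) (Complex.I * (Real.sqrt d : ℂ)) = (c : ℂ) ^ (2 * n) :=
    fun c ↦ detOnEigenspace_kTorus hd hφ (hT₁ c) hA _
  -- (2) Hodge classes are fixed by `G = S(A)(ℂ) ∩ SU_K`
  have hfixG : ∀ {p : ℕ} {x : complexBetti A.X (2 * p)}, x ∈ hodgeClassSpan A.dim A.X p →
      ∀ (u : complexBetti A.X 1 ≃ₗ[ℂ] complexBetti A.X 1) (hu : u ∈ unitaryCentralizerGroup A h),
        detOnEigenspace u (pullbackOne A φ) (fun x ↦ (mem_centralizerGroup_iff.1 hu.1) φ x)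
          (Complex.I * (Real.sqrt d : ℂ)) = 1 →
        extAct (u : complexBetti A.X 1 →ₗ[ℂ] complexBetti A.X 1) (2 * p) x = x := by
    intro p x hx u hu hdet
    obtain ⟨g, hg, rfl⟩ := mem_hodgeGroupOne_iff.1 (hG u hu hdet)
    rw [← hodgeGroup_apply_eq_extAct hg]
    exact apply_eq_self_of_mem_hodgeClassSpan hg hx
  -- (3) the torus element `t_ζ` lies in `G`
  have hζdet : detOnEigenspace (T ζ) (pullbackOne A φ)
      (fun x ↦ (mem_centralizerGroup_iff.1 (hTmem ζ).1) φ x) (Complex.I * (Real.sqrt d : ℂ)) = 1 := by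
    rw [hTdet ζ]; exact hζ'.pow_eq_one
  -- (4) the main argument in degree `q = 2p`
  have key : ∀ (p : ℕ) (x : complexBetti A.X (2 * p)), x ∈ hodgeClassSpan A.dim A.X p →
      ∃ x₀ : complexBetti A.X (2 * p), x₀ ∈ divisorClassesSpan A.X A.dim p ∧
        ∀ s : Set.powersetCard (Fin (2 * n + 2 * n)) (2 * p), (monB B1 (2 * p)).repr (x - x₀) s ≠ 0 →
          ((s.val.filter fun j ↦ j.val < 2 * n).card = 2 * n ∧ (s.val.filter fun j ↦ ¬ j.val < 2 * n).card = 0) ∨ ((s.val.filter fun j ↦ j.val < 2 * n).card = 0 ∧ (s.val.filter fun j ↦ ¬ j.val < 2 * n).card = 2 * n) := by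
    intro p x hx
    -- the balanced projector
    obtain ⟨P, hP⟩ := exists_balancedProjector (hT₁ two) (hT₂ two) hb₁ hb₂ rfl (2 * p)
    set L := extAct (T two : complexBetti A.X 1 →ₗ[ℂ] complexBetti A.X 1) (2 * p) with hL
    set x₀ := aeval L P x with hx₀
    -- coordinates of `x₀`
    have hrepr₀ : ∀ s : Set.powersetCard (Fin (2 * n + 2 * n)) (2 * p),
        (monB B1 (2 * p)).repr x₀ s = if (s.val.filter fun j ↦ j.val < 2 * n).card = (s.val.filter fun j ↦ ¬ j.val < 2 * n).card then (monB B1 (2 * p)).repr x s else 0 := by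
      intro s
      have hexp : x₀ = ∑ u, (monB B1 (2 * p)).repr x u • aeval L P (monB B1 (2 * p) u) := by
        conv_lhs => rw [hx₀, ← (monB B1 (2 * p)).sum_repr x, map_sum]
        simp_rw [map_smul]
      rw [hexp, map_sum, Finset.sum_apply']
      simp_rw [map_smul, hP, Finsupp.smul_apply]
      rw [Finset.sum_eq_single s]
      · by_cases hs : (s.val.filter fun j ↦ j.val < 2 * n).card = (s.val.filter fun j ↦ ¬ j.val < 2 * n).card
        · rw [if_pos hs, if_pos hs, Module.Basis.repr_self, Finsupp.single_eq_same, smul_eq_mul, mul_one]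
        · rw [if_neg hs, if_neg hs, map_zero, Finsupp.zero_apply, smul_zero]
      · intro u _ hus
        by_cases hu : (u.val.filter fun j ↦ j.val < 2 * n).card = (u.val.filter fun j ↦ ¬ j.val < 2 * n).card
        · rw [if_pos hu, Module.Basis.repr_self, Finsupp.single_eq_of_ne (Ne.symm hus), smul_zero]
        · rw [if_neg hu, map_zero, Finsupp.zero_apply, smul_zero]
      · intro hs; exact absurd (Finset.mem_univ s) hs
    refine ⟨x₀, ?_, fun s hs ↦ ?_⟩
    · -- `x₀` is `S(A)(ℂ)`-invariant, hence divisorial by Milne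
      refine mem_divisorClassesSpan_of_forall_mem_unitaryCentralizerGroup A hh hnd p x₀ fun u hu ↦ ?_
      change extAct (u : complexBetti A.X 1 →ₗ[ℂ] complexBetti A.X 1) (2 * p) x₀ = x₀
      -- factor `u = t_c · g` with `g ∈ G`
      set δ := detOnEigenspace u (pullbackOne A φ) (fun x ↦ (mem_centralizerGroup_iff.1 hu.1) φ x)
        (Complex.I * (Real.sqrt d : ℂ)) with hδ
      obtain ⟨c₁, hc₁⟩ := IsAlgClosed.exists_pow_nat_eq δ h2n
      have hδ0 : δ ≠ 0 := by
        intro h0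
        have hui : u⁻¹ ∈ unitaryCentralizerGroup A h := (unitaryCentralizerGroup A h).inv_mem hu
        have hm := detOnEigenspace_mul (fun x ↦ (mem_centralizerGroup_iff.1 hu.1) φ x)
          (fun x ↦ (mem_centralizerGroup_iff.1 hui.1) φ x)
          (fun x ↦ (mem_centralizerGroup_iff.1 ((unitaryCentralizerGroup A h).mul_mem hu hui).1) φ x)
          (Complex.I * (Real.sqrt d : ℂ))
        rw [← hδ, h0, zero_mul, detOnEigenspace_congr (T := pullbackOne A φ) (mul_inv_cancel u) _ (fun _ ↦ rfl),
          detOnEigenspace_one] at hm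
        exact one_ne_zero hm
      have hc₁0 : c₁ ≠ 0 := by rintro rfl; rw [zero_pow h2n.ne'] at hc₁; exact hδ0 hc₁.symm
      set c : ℂˣ := Units.mk0 c₁ hc₁0 with hc
      set g := T c⁻¹ * u with hg
      have hgmem : g ∈ unitaryCentralizerGroup A h := (unitaryCentralizerGroup A h).mul_mem (hTmem c⁻¹) hu
      have hgdet : detOnEigenspace g (pullbackOne A φ) (fun x ↦ (mem_centralizerGroup_iff.1 hgmem.1) φ x)
          (Complex.I * (Real.sqrt d : ℂ)) = 1 := by
        rw [detOnEigenspace_congr (T := pullbackOne A φ) hg _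
            (fun x ↦ (mem_centralizerGroup_iff.1 ((unitaryCentralizerGroup A h).mul_mem (hTmem c⁻¹) hu).1) φ x),
          detOnEigenspace_mul (fun x ↦ (mem_centralizerGroup_iff.1 (hTmem c⁻¹).1) φ x)
            (fun x ↦ (mem_centralizerGroup_iff.1 hu.1) φ x), hTdet c⁻¹]
        change ((c⁻¹ : ℂˣ) : ℂ) ^ (2 * n) * δ = 1
        rw [← hc₁, Units.val_inv_eq_inv_val, hc, Units.val_mk0, inv_pow]
        exact inv_mul_cancel₀ (pow_ne_zero _ hc₁0)
      -- `⋀g` fixes `x` and commutes with `L`, hence fixes `x₀`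
      have hgx : extAct (g : complexBetti A.X 1 →ₗ[ℂ] complexBetti A.X 1) (2 * p) x = x := hfixG hx g hgmem hgdet
      have hgL : Commute (extAct (g : complexBetti A.X 1 →ₗ[ℂ] complexBetti A.X 1) (2 * p)) L := by
        change extAct (g : complexBetti A.X 1 →ₗ[ℂ] complexBetti A.X 1) (2 * p) * L =
          L * extAct (g : complexBetti A.X 1 →ₗ[ℂ] complexBetti A.X 1) (2 * p)
        rw [hL, Module.End.mul_eq_comp, Module.End.mul_eq_comp, ← extAct_comp, ← extAct_comp]
        congr 1
        refine LinearMap.ext fun v ↦ ?_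
        rw [LinearMap.comp_apply, LinearMap.comp_apply, LinearEquiv.coe_coe, LinearEquiv.coe_coe]
        exact kTorus_comm_of_comm hd hφ (hT₁ two) (hT₂ two) (g := (g : complexBetti A.X 1 →ₗ[ℂ] complexBetti A.X 1))
          (fun x ↦ (mem_centralizerGroup_iff.1 hgmem.1) φ x) v
      have hgx₀ : extAct (g : complexBetti A.X 1 →ₗ[ℂ] complexBetti A.X 1) (2 * p) x₀ = x₀ := by
        rw [hx₀]
        have e := (commute_aeval_of_commute hgL P).eq
        have e' := LinearMap.congr_fun e x
        rw [Module.End.mul_apply, Module.End.mul_apply, hgx] at e'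
        exact e'
      -- `⋀t_c` fixes `x₀` (balanced coordinates)
      have htx₀ : extAct (T c : complexBetti A.X 1 →ₗ[ℂ] complexBetti A.X 1) (2 * p) x₀ = x₀ := by
        refine (monB B1 (2 * p)).ext_elem fun s ↦ ?_
        rw [repr_extAct_kTorus (hT₁ c) (hT₂ c) hb₁ hb₂ (2 * p) x₀ s, hrepr₀ s]
        by_cases hs : (s.val.filter fun j ↦ j.val < 2 * n).card = (s.val.filter fun j ↦ ¬ j.val < 2 * n).card
        · rw [if_pos hs, hs, Units.val_inv_eq_inv_val, inv_pow, mul_inv_cancel₀ (pow_ne_zero _ (Units.ne_zero c)), one_mul]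
        · rw [if_neg hs, mul_zero]
      -- assemble: `u = t_c · g`
      have hu_eq : (u : complexBetti A.X 1 →ₗ[ℂ] complexBetti A.X 1) =
          (T c : complexBetti A.X 1 →ₗ[ℂ] complexBetti A.X 1) ∘ₗ (g : complexBetti A.X 1 →ₗ[ℂ] complexBetti A.X 1) := by
        refine LinearMap.ext fun v ↦ ?_
        have e1 := LinearEquiv.congr_fun
          (kTorus_mul_kTorus_inv hd hφ (hT₁ c) (hT₂ c) (t' := T c⁻¹) (hT₁ c⁻¹) (hT₂ c⁻¹)) (u v)
        change T c (T c⁻¹ (u v)) = u v at e1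
        rw [LinearMap.comp_apply, LinearEquiv.coe_coe, LinearEquiv.coe_coe, hg]
        change u v = T c ((T c⁻¹ * u) v)
        rw [LinearEquiv.mul_apply, e1]
      rw [hu_eq, extAct_comp, LinearMap.comp_apply, hgx₀, htx₀]
    · -- the coordinates of `x - x₀` live on the tops
      have hxζ : extAct (T ζ : complexBetti A.X 1 →ₗ[ℂ] complexBetti A.X 1) (2 * p) x = x :=
        hfixG hx _ (hTmem ζ) hζdet
      have hs' : (monB B1 (2 * p)).repr x s ≠ 0 ∧ ¬ (s.val.filter fun j ↦ j.val < 2 * n).card = (s.val.filter fun j ↦ ¬ j.val < 2 * n).card := by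
        rw [map_sub, Finsupp.sub_apply, hrepr₀ s] at hs
        by_cases hbal : (s.val.filter fun j ↦ j.val < 2 * n).card = (s.val.filter fun j ↦ ¬ j.val < 2 * n).card
        · rw [if_pos hbal, sub_self] at hs; exact absurd rfl hs
        · rw [if_neg hbal, sub_zero] at hs; exact ⟨hs, hbal⟩
      rcases balanced_or_top_of_repr_ne_zero (hT₁ ζ) (hT₂ ζ) hb₁ hb₂ hζ' hxζ hs'.1 with hbal | htop
      · exact absurd hbal hs'.2
      · exact htop
  -- (5) conclusion
  refine ⟨fun p c hpn hcQ hcH ↦ ?_, fun c hcQ hcH ↦ ?_⟩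
  · -- off the middle degree: no top index set has `2p` elements
    have hc : c ∈ hodgeClassSpan A.dim A.X p := Submodule.subset_span ⟨hcQ, hcH⟩
    obtain ⟨x₀, hx₀, htop⟩ := key p c hc
    have hcx : c = x₀ := by
      rw [← sub_eq_zero]
      refine (monB B1 (2 * p)).ext_elem fun s ↦ ?_
      rw [map_zero, Finsupp.zero_apply]
      by_contra hs
      have hcard : (s.val.filter fun j ↦ j.val < 2 * n).card + (s.val.filter fun j ↦ ¬ j.val < 2 * n).card = 2 * p := by rw [card_filter_lt_add, s.prop]
      rcases htop s hs with ⟨ha, hb⟩ | ⟨ha, hb⟩ <;> omega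
    rw [hcx]; exact hx₀
  · -- the middle degree: the tops are Weil classes
    have hc : c ∈ hodgeClassSpan A.dim A.X n := Submodule.subset_span ⟨hcQ, hcH⟩
    obtain ⟨x₀, hx₀, htop⟩ := key n c hc
    have hrest : c - x₀ ∈ weilClassesOf A φ n d := by
      rw [← (monB B1 (2 * n)).sum_repr (c - x₀)]
      refine Submodule.sum_mem _ fun s _ ↦ ?_
      by_cases hs : (monB B1 (2 * n)).repr (c - x₀) s = 0
      · rw [hs, zero_smul]; exact Submodule.zero_mem _
      refine Submodule.smul_mem _ _ ?_
      rcases htop s hs with ⟨-, hb⟩ | ⟨ha, -⟩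
      · exact Submodule.mem_sup_left (monB_mem_weilClassesPlus hb₁ s (forall_lt_of_top s.val hb))
      · exact Submodule.mem_sup_right (monB_mem_weilClassesMinus hb₂ s (forall_le_of_top s.val ha))
    have hc' : c = x₀ + (c - x₀) := by abel
    rw [hc']
    exact Submodule.add_mem_sup hx₀ hrest

end Literature.AlgebraicGeometry.HodgeTheory
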